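import Mathlib
import Literature.NumberTheory.LFunctions.Zhang2022.TypedSection16A
import HarnessLib

/-!
# Zhang (2022), §16 (16.10): sizes of the regular factor `Φ(s) = ζ(1+s+β₁)ℳ₂(d,l;1+s)/(ζ(1+s)L(1+s,χ))·d^{−s}`
# on the pieces of Landau's contour, and of the residue at the exceptional-zero pole

Topic `Literature/NumberTheory/LFunctions/Zhang2022` (Landau–Siegel audit tree; verdict-neutral).
Y. Zhang, *Discrete mean estimates and the Landau–Siegel zero*, arXiv:2211.02515v1 (2022)
[Zhang2022LandauSiegel] — **an unrefereed manuscript under adjudication**; nothing here asserts its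
Theorems 1–2. DAG node `Z22:(16.10)` [Z22 p.92, tex L4550]: "In a way similar to the proof of (15.15)
[sc. of Lemma 8.4: Landau's broken line, p.44], we deduce that
`𝒟₂(d,l) = λ₂(d)Σ_{j=1,2}ℛ₂ⱼd^{βⱼ}ℳ₂(d,l;1−βⱼ) + O(ε₁)`".

The contour engine of the tree (`GaussKernelContour.norm_lineIntegral_sub_sum_limUnder_le`, the
Gaussian-kernel twin of the Lemma 8.4 engine) wants sup-bounds `M₀, M₁, M₂` of the regular factor `Φ`
of the integrand of §16.u023 (`Eq1610.integrand16_u023_eq_mul_kernel`) on the line `Re s = 1`, on the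
left segment `Re s = −η`, `|t| ≤ H`, and on the horizontal sides `Im s = ±H`. This file derives them —
in the style of the tree's `Lemma84.norm_Phi_left_le`/`norm_Phi_horiz_le` (`Section8Lemma84PhiBounds`) —
from PACKAGED analytic inputs, all of which are tree theorems supplied by the assembling file:
the classical region for `ζ` (`ZetaClassicalRegion.exists_zeroFreeRegion_bounds`:
`‖ζ(w) − (w−1)⁻¹‖, ‖ζ(w)⁻¹‖ ≤ B_ζ`), the zero-free package for `L(·,χ)` under (A) with the exceptional
zero `ρ̃` (`Lemma84.exceptional_package`: `‖L(s,χ)⁻¹‖ ≤ M_inv(1 + |s−ρ̃|⁻¹)`), the bound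
`‖ℳ₂(d,l;w)‖ ≤ M_U` on `Re w > 9/10` (node §16.u022), and `‖ζ‖, ‖ζ⁻¹‖, ‖L⁻¹‖ ≤ 2` on `Re w ≥ 2`:

* `norm_Phi_le_of_bounds` — the product of five norms;
* `norm_Phi_line_le` (`Re s = 1`: `≤ 8M_U/d`), `norm_Phi_left_le` (`Re s = −η`:
  `≤ (η⁻¹ + B_ζ)M_U B_ζ M_inv(1 + 2/η)·d^{η}`), `norm_Phi_horiz_le` (`Im s = ±H`:
  `≤ (1 + B_ζ)M_U B_ζ·3M_inv·d`);
* `norm_inv_deriv_le_of_inv_bound` — `‖L′(ρ̃,χ)⁻¹‖ ≤ M_inv` from the inverse bound next to `ρ̃`;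
* `norm_excZero_residue_le` — the residue at `s = ρ̃ − 1` is
  `≤ M_inv·(b₁⁻¹ + B_ζ)·M_U·2(1−ρ̃)·e·(e/b₂)`: POLYNOMIALLY small in `𝓛` through `1 − ρ̃ ≤ K𝓛⁻²⁰²²`
  (Lemma 5.5), not `O(ε₁)` — the size the manuscript "regards as an acceptable error" (p.85, tex L4224).

No parameter of the manuscript is fixed here; nothing about Landau–Siegel zeros is asserted.

## References

* Y. Zhang, arXiv:2211.02515v1 (2022), §16 (16.10) p.92; §15 (15.15)–(15.16) p.85; §8 proofs of
  Lemmas 8.2, 8.4 pp.44–47. [cite: Zhang2022LandauSiegel, §16 (16.10) p.92]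
* H. L. Montgomery, R. C. Vaughan, *Multiplicative Number Theory I*, CUP 2007, Thm 6.7, Thm 11.4,
  §6.2. [cite: MontgomeryVaughan2007, Thm 11.4]
-/

noncomputable section

open Complex Real

namespace Literature.NumberTheory.LFunctions.Zhang2022.Eq1610

/-! ## The product of five norms -/

/-- **`‖Φ‖` from bounds on its five factors**: if `‖a‖ ≤ A₁`, `‖m‖ ≤ A₂`, `‖z⁻¹‖ ≤ A₃`,
`‖L⁻¹‖ ≤ A₄`, `‖e‖ ≤ A₅` (`Aᵢ ≥ 0`) then `‖a·m/(z·L)·e‖ ≤ A₁A₂A₃A₄A₅`. [cite: Zhang2022LandauSiegel, §16 (16.10) p.92] -/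
theorem norm_Phi_le_of_bounds {a m z L e : ℂ} {A₁ A₂ A₃ A₄ A₅ : ℝ} (h₁ : ‖a‖ ≤ A₁) (h₂ : ‖m‖ ≤ A₂)
    (h₃ : ‖z⁻¹‖ ≤ A₃) (h₄ : ‖L⁻¹‖ ≤ A₄) (h₅ : ‖e‖ ≤ A₅) (hA₁ : 0 ≤ A₁) (hA₂ : 0 ≤ A₂) (hA₃ : 0 ≤ A₃)
    (hA₄ : 0 ≤ A₄) :
    ‖a * m / (z * L) * e‖ ≤ A₁ * A₂ * A₃ * A₄ * A₅ := by
  have hrw : a * m / (z * L) * e = a * m * z⁻¹ * L⁻¹ * e := by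
    rw [div_eq_mul_inv, mul_inv]; ring
  rw [hrw, norm_mul, norm_mul, norm_mul, norm_mul]
  have hA₅ : 0 ≤ A₅ := le_trans (norm_nonneg _) h₅
  gcongr

/-- `‖(d^s)⁻¹‖ = d^{−Re s}` for `d ≥ 1`. [cite: Zhang2022LandauSiegel, §16 (16.10) p.92] -/
theorem norm_cpow_inv_eq {d : ℕ} (hd : d ≠ 0) (s : ℂ) : ‖((d : ℂ) ^ s)⁻¹‖ = (d : ℝ) ^ (-s.re) := by
  have hd' : (0 : ℝ) < d := by exact_mod_cast Nat.pos_of_ne_zero hd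
  rw [norm_inv, show (d : ℂ) = ((d : ℝ) : ℂ) by norm_cast, Complex.norm_cpow_eq_rpow_re_of_pos hd',
    Real.rpow_neg hd'.le]

/-- `‖(d^s)⁻¹‖ ≤ d^{η}` when `−η ≤ Re s` (`d ≥ 1`). [cite: Zhang2022LandauSiegel, §16 (16.10) p.92] -/
theorem norm_cpow_inv_le {d : ℕ} (hd : d ≠ 0) {s : ℂ} {η : ℝ} (hs : -η ≤ s.re) :
    ‖((d : ℂ) ^ s)⁻¹‖ ≤ (d : ℝ) ^ η := by
  rw [norm_cpow_inv_eq hd]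
  have hd1 : (1 : ℝ) ≤ d := by exact_mod_cast Nat.one_le_iff_ne_zero.mpr hd
  exact Real.rpow_le_rpow_of_exponent_le hd1 (by linarith)

/-! ## `Φ` on the line `Re s = 1` -/

section Line

variable {D : ℕ} [NeZero D] (χ : DirichletCharacter ℂ D) (M : ℂ → ℂ) (β₁ : ℂ) {d : ℕ} {MU : ℝ}

/-- **`Φ` on `Re s = 1`** (and, more generally, `Re s ≥ 1`): with `‖ℳ(w)‖ ≤ M_U` for `Re w ≥ 2` and
the elementary `‖ζ(w)‖, ‖ζ(w)⁻¹‖, ‖L(w,χ)⁻¹‖ ≤ 2` for `Re w ≥ 2` supplied as hypotheses,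
`‖Φ(s)‖ ≤ 8M_U` for `Re s ≥ 1`, `Re β₁ = 0`, `d ≥ 1`.
[cite: Zhang2022LandauSiegel, §16 (16.10) p.92] [cite: MontgomeryVaughan2007, Lemma 11.1] -/
theorem norm_Phi_line_le (hd : d ≠ 0) (hβ₁ : β₁.re = 0) (hMU : 0 ≤ MU)
    (hM : ∀ w : ℂ, 2 ≤ w.re → ‖M w‖ ≤ MU)
    (hζ2 : ∀ w : ℂ, 2 ≤ w.re → ‖riemannZeta w‖ ≤ 2 ∧ ‖(riemannZeta w)⁻¹‖ ≤ 2)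
    (hL2 : ∀ w : ℂ, 2 ≤ w.re → ‖(χ.LFunction w)⁻¹‖ ≤ 2)
    {s : ℂ} (hs : 1 ≤ s.re) :
    ‖riemannZeta (1 + s + β₁) * M (1 + s) / (riemannZeta (1 + s) * χ.LFunction (1 + s)) *
      ((d : ℂ) ^ s)⁻¹‖ ≤ 8 * MU := by
  have hw : 2 ≤ (1 + s).re := by simp; linarith
  have hw1 : 2 ≤ (1 + s + β₁).re := by simp [hβ₁]; linarith
  have h5 : ‖((d : ℂ) ^ s)⁻¹‖ ≤ 1 := by
    have h := norm_cpow_inv_le (η := 0) hd (s := s) (by linarith)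
    rwa [Real.rpow_zero] at h
  calc _ ≤ 2 * MU * 2 * 2 * 1 := norm_Phi_le_of_bounds (hζ2 _ hw1).1 (hM _ hw) (hζ2 _ hw).2 (hL2 _ hw) h5
        (by norm_num) hMU (by norm_num) (by norm_num)
    _ = 8 * MU := by ring

end Line

/-! ## `Φ` on the left segment and on the horizontal sides -/

section LeftHoriz

variable {D : ℕ} [NeZero D] (χ : DirichletCharacter ℂ D) (M : ℂ → ℂ) (β₁ : ℂ)
variable {d : ℕ} {ρ η T' MU Bζ Minv : ℝ}

/-- **`Φ` on the left side `Re s = −η`** (`|t| ≤ T′`): with `‖ℳ(w)‖ ≤ M_U` on `Re w ≥ 1 − η`, the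
classical region for `ζ` in the packaged form `‖ζ(w) − (w−1)⁻¹‖, ‖ζ(w)⁻¹‖ ≤ B_ζ`
(`Re w ≥ 1 − 2η`, `|Im w| ≤ T′ + 2`, `w ≠ 1`), the zero-free package `‖L(s,χ)⁻¹‖ ≤ M_inv(1 + |s−ρ̃|⁻¹)`
(`Re s ≥ 1 − 2η`, `|Im s| ≤ T′ + 1`, `s ≠ ρ̃`) and `ρ̃ ≥ 1 − η/2`, `‖β₁‖ ≤ 1`, `Re β₁ = 0`:
`‖Φ(−η + it)‖ ≤ (η⁻¹ + B_ζ)·M_U·B_ζ·M_inv(1 + 2/η)·d^{η}` (`|w + β₁ − 1| ≥ η`, `|w − ρ̃| ≥ η/2`).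
[cite: Zhang2022LandauSiegel, §16 (16.10) p.92] [cite: MontgomeryVaughan2007, Thm 11.4] -/
theorem norm_Phi_left_le (hd : d ≠ 0) (hη : 0 < η) (hβ₁ : β₁.re = 0) (hβ₁1 : ‖β₁‖ ≤ 1)
    (hMU : 0 ≤ MU) (hM : ∀ w : ℂ, 1 - η ≤ w.re → ‖M w‖ ≤ MU) (hBζ : 0 ≤ Bζ)
    (hζ : ∀ w : ℂ, w ≠ 1 → 1 - 2 * η ≤ w.re → |w.im| ≤ T' + 2 →
      ‖riemannZeta w - (w - 1)⁻¹‖ ≤ Bζ ∧ ‖(riemannZeta w)⁻¹‖ ≤ Bζ)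
    (hMinv : 0 ≤ Minv)
    (hpack : ∀ s : ℂ, 1 - 2 * η ≤ s.re → |s.im| ≤ T' + 1 → s ≠ (ρ : ℂ) →
      χ.LFunction s ≠ 0 ∧ ‖(χ.LFunction s)⁻¹‖ ≤ Minv * (1 + ‖s - ρ‖⁻¹))
    (hρ : 1 - η / 2 ≤ ρ) {t : ℝ} (ht : |t| ≤ T') :
    ‖riemannZeta (1 + (((-η : ℝ) : ℂ) + t * I) + β₁) * M (1 + (((-η : ℝ) : ℂ) + t * I)) /
        (riemannZeta (1 + (((-η : ℝ) : ℂ) + t * I)) * χ.LFunction (1 + (((-η : ℝ) : ℂ) + t * I))) *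
      ((d : ℂ) ^ (((-η : ℝ) : ℂ) + t * I))⁻¹‖ ≤
      (η⁻¹ + Bζ) * MU * Bζ * (Minv * (1 + 2 / η)) * (d : ℝ) ^ η := by
  set s : ℂ := ((-η : ℝ) : ℂ) + t * I with hs
  have hsre : s.re = -η := by simp [hs]
  have hsim : s.im = t := by simp [hs]
  have hβim : |β₁.im| ≤ 1 := (Complex.abs_im_le_norm β₁).trans hβ₁1
  -- the point `w = 1 + s` and `w + β₁`
  have hwre : (1 + s).re = 1 - η := by simp [hsre]; ring
  have hwim : (1 + s).im = t := by simp [hsim]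
  have hw1re : (1 + s + β₁).re = 1 - η := by simp [hsre, hβ₁]; ring
  have hw1im : (1 + s + β₁).im = t + β₁.im := by simp [hsim]
  -- `ζ(w + β₁)`: `|w + β₁ − 1| ≥ η`
  have hw1ne : 1 + s + β₁ ≠ 1 := by
    intro h; have := congrArg Complex.re h; rw [hw1re, Complex.one_re] at this; linarith
  have hdist : η ≤ ‖1 + s + β₁ - 1‖ := by
    have h1 := Complex.abs_re_le_norm (1 + s + β₁ - 1)
    have h2 : (1 + s + β₁ - 1).re = -η := by simp [hsre, hβ₁]
    rw [h2, abs_neg, abs_of_pos hη] at h1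
    exact h1
  obtain ⟨hζa, -⟩ := hζ (1 + s + β₁) hw1ne (by rw [hw1re]; linarith)
    (by rw [hw1im]; have := abs_add_le t β₁.im; linarith)
  have hA₁ : ‖riemannZeta (1 + s + β₁)‖ ≤ η⁻¹ + Bζ := by
    have hinv : ‖(1 + s + β₁ - 1)⁻¹‖ ≤ η⁻¹ := by
      rw [norm_inv]; exact inv_anti₀ hη hdist
    calc ‖riemannZeta (1 + s + β₁)‖
        ≤ ‖riemannZeta (1 + s + β₁) - (1 + s + β₁ - 1)⁻¹‖ + ‖(1 + s + β₁ - 1)⁻¹‖ := by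
          have := norm_add_le (riemannZeta (1 + s + β₁) - (1 + s + β₁ - 1)⁻¹) ((1 + s + β₁ - 1)⁻¹)
          rwa [sub_add_cancel] at this
      _ ≤ Bζ + η⁻¹ := add_le_add hζa hinv
      _ = η⁻¹ + Bζ := add_comm _ _
  -- `ζ(w)⁻¹`
  have hwne : 1 + s ≠ 1 := by
    intro h; have := congrArg Complex.re h; rw [hwre, Complex.one_re] at this; linarith
  obtain ⟨-, hA₃⟩ := hζ (1 + s) hwne (by rw [hwre]; linarith) (by rw [hwim]; linarith)
  -- `L(w)⁻¹`: `|w − ρ| ≥ η/2`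
  have hwρ : η / 2 ≤ ‖(1 + s) - ρ‖ := by
    have h1 : |((1 + s) - ρ).re| ≤ ‖(1 + s) - ρ‖ := Complex.abs_re_le_norm _
    have h2 : ((1 + s) - ρ).re = 1 - η - ρ := by rw [sub_re, hwre, Complex.ofReal_re]
    rw [h2] at h1
    have h3 : η / 2 ≤ |1 - η - ρ| := by rw [abs_of_nonpos (by linarith)]; linarith
    exact h3.trans h1
  have hwneρ : (1 + s) ≠ (ρ : ℂ) := by
    intro h; rw [h, sub_self, norm_zero] at hwρ; linarith
  obtain ⟨-, hinv⟩ := hpack (1 + s) (by rw [hwre]; linarith) (by rw [hwim]; linarith) hwneρ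
  have hA₄ : ‖(χ.LFunction (1 + s))⁻¹‖ ≤ Minv * (1 + 2 / η) := by
    refine hinv.trans (mul_le_mul_of_nonneg_left ?_ hMinv)
    have : ‖(1 + s) - ρ‖⁻¹ ≤ 2 / η := by
      rw [inv_le_comm₀ (lt_of_lt_of_le (by positivity) hwρ) (by positivity), inv_div]
      exact hwρ
    linarith
  -- `ℳ(w)` and `(d^s)⁻¹`
  have hA₂ := hM (1 + s) (by rw [hwre])
  have hA₅ : ‖((d : ℂ) ^ s)⁻¹‖ ≤ (d : ℝ) ^ η := norm_cpow_inv_le hd (by rw [hsre])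
  exact norm_Phi_le_of_bounds hA₁ hA₂ hA₃ hA₄ hA₅ (by positivity) hMU hBζ (by positivity)

/-- **`Φ` on the horizontal sides `Im s = ±T′`** (`−η ≤ Re s`, `η ≤ 1`, `T′ ≥ 2`): with the same packages
(`ζ` on `Re w ≥ 1 − 2η`, `|Im w| ≤ T′ + 2`; `L` on `|Im| ≤ T′ + 1`),
`‖Φ(x ± iT′)‖ ≤ (1 + B_ζ)·M_U·B_ζ·(3M_inv)·d` (`|Im(w + β₁)| ≥ T′ − 1 ≥ 1`, `|w − ρ̃| ≥ T′ − 0 ≥ 1/2`).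
[cite: Zhang2022LandauSiegel, §16 (16.10) p.92] [cite: MontgomeryVaughan2007, Thm 11.4] -/
theorem norm_Phi_horiz_le (hd : d ≠ 0) (hη : 0 < η) (hη1 : η ≤ 1) (hT : 2 ≤ T') (hβ₁ : β₁.re = 0)
    (hβ₁1 : ‖β₁‖ ≤ 1) (hMU : 0 ≤ MU) (hM : ∀ w : ℂ, 1 - η ≤ w.re → ‖M w‖ ≤ MU) (hBζ : 0 ≤ Bζ)
    (hζ : ∀ w : ℂ, w ≠ 1 → 1 - 2 * η ≤ w.re → |w.im| ≤ T' + 2 →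
      ‖riemannZeta w - (w - 1)⁻¹‖ ≤ Bζ ∧ ‖(riemannZeta w)⁻¹‖ ≤ Bζ)
    (hMinv : 0 ≤ Minv)
    (hpack : ∀ s : ℂ, 1 - 2 * η ≤ s.re → |s.im| ≤ T' + 1 → s ≠ (ρ : ℂ) →
      χ.LFunction s ≠ 0 ∧ ‖(χ.LFunction s)⁻¹‖ ≤ Minv * (1 + ‖s - ρ‖⁻¹))
    {x y : ℝ} (hx1 : -η ≤ x) (hy : |y| = T') :
    ‖riemannZeta (1 + ((x : ℂ) + y * I) + β₁) * M (1 + ((x : ℂ) + y * I)) /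
        (riemannZeta (1 + ((x : ℂ) + y * I)) * χ.LFunction (1 + ((x : ℂ) + y * I))) *
      ((d : ℂ) ^ ((x : ℂ) + y * I))⁻¹‖ ≤
      (1 + Bζ) * MU * Bζ * (Minv * 3) * (d : ℝ) ^ (1 : ℝ) := by
  set s : ℂ := (x : ℂ) + y * I with hs
  have hsre : s.re = x := by simp [hs]
  have hsim : s.im = y := by simp [hs]
  have hβim : |β₁.im| ≤ 1 := (Complex.abs_im_le_norm β₁).trans hβ₁1
  have hwre : (1 + s).re = 1 + x := by simp [hsre]
  have hwim : (1 + s).im = y := by simp [hsim]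
  have hw1re : (1 + s + β₁).re = 1 + x := by simp [hsre, hβ₁]
  have hw1im : (1 + s + β₁).im = y + β₁.im := by simp [hsim]
  -- `|Im(w + β₁)| ≥ T′ − 1 ≥ 1`
  have him1 : 1 ≤ |y + β₁.im| := by
    have h := abs_sub_abs_le_abs_sub y (-β₁.im)
    rw [sub_neg_eq_add, abs_neg, hy] at h
    linarith
  have hw1ne : 1 + s + β₁ ≠ 1 := by
    intro h; have := congrArg Complex.im h
    rw [hw1im, Complex.one_im] at this
    rw [this, abs_zero] at him1; linarith
  have hdist : 1 ≤ ‖1 + s + β₁ - 1‖ := by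
    have h1 := Complex.abs_im_le_norm (1 + s + β₁ - 1)
    have h2 : (1 + s + β₁ - 1).im = y + β₁.im := by simp [hsim]
    rw [h2] at h1
    exact him1.trans h1
  obtain ⟨hζa, -⟩ := hζ (1 + s + β₁) hw1ne (by rw [hw1re]; linarith)
    (by rw [hw1im]; have := abs_add_le y β₁.im; rw [hy] at this; linarith)
  have hA₁ : ‖riemannZeta (1 + s + β₁)‖ ≤ 1 + Bζ := by
    have hinv : ‖(1 + s + β₁ - 1)⁻¹‖ ≤ 1 := by
      rw [norm_inv]; exact inv_le_one_of_one_le₀ hdist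
    calc ‖riemannZeta (1 + s + β₁)‖
        ≤ ‖riemannZeta (1 + s + β₁) - (1 + s + β₁ - 1)⁻¹‖ + ‖(1 + s + β₁ - 1)⁻¹‖ := by
          have := norm_add_le (riemannZeta (1 + s + β₁) - (1 + s + β₁ - 1)⁻¹) ((1 + s + β₁ - 1)⁻¹)
          rwa [sub_add_cancel] at this
      _ ≤ Bζ + 1 := add_le_add hζa hinv
      _ = 1 + Bζ := add_comm _ _
  -- `ζ(w)⁻¹`
  have hwne : 1 + s ≠ 1 := by
    intro h; have := congrArg Complex.im h
    rw [hwim, Complex.one_im] at this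
    rw [this, abs_zero] at hy; linarith
  obtain ⟨-, hA₃⟩ := hζ (1 + s) hwne (by rw [hwre]; linarith) (by rw [hwim, hy]; linarith)
  -- `L(w)⁻¹`: `|w − ρ| ≥ |Im w| = T′ ≥ 2`
  have hwρ : 1 / 2 ≤ ‖(1 + s) - ρ‖ := by
    have h1 : |((1 + s) - ρ).im| ≤ ‖(1 + s) - ρ‖ := Complex.abs_im_le_norm _
    have h2 : ((1 + s) - ρ).im = y := by rw [sub_im, hwim, Complex.ofReal_im, sub_zero]
    rw [h2, hy] at h1
    linarith
  have hwneρ : (1 + s) ≠ (ρ : ℂ) := by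
    intro h; rw [h, sub_self, norm_zero] at hwρ; linarith
  obtain ⟨-, hinv⟩ := hpack (1 + s) (by rw [hwre]; linarith) (by rw [hwim, hy]; linarith) hwneρ
  have hA₄ : ‖(χ.LFunction (1 + s))⁻¹‖ ≤ Minv * 3 := by
    refine hinv.trans (mul_le_mul_of_nonneg_left ?_ hMinv)
    have : ‖(1 + s) - ρ‖⁻¹ ≤ 2 := by
      rw [inv_le_comm₀ (lt_of_lt_of_le (by positivity) hwρ) (by positivity)]
      linarith
    linarith
  have hA₂ := hM (1 + s) (by rw [hwre]; linarith)
  have hA₅ : ‖((d : ℂ) ^ s)⁻¹‖ ≤ (d : ℝ) ^ (1 : ℝ) := norm_cpow_inv_le hd (by rw [hsre]; linarith)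
  exact norm_Phi_le_of_bounds hA₁ hA₂ hA₃ hA₄ hA₅ (by positivity) hMU hBζ (by positivity)

end LeftHoriz

/-! ## The exceptional-zero pole: `‖L′(ρ̃,χ)⁻¹‖` and the size of the residue -/

section ExcZero

variable {D : ℕ} [NeZero D] (χ : DirichletCharacter ℂ D)

/-- **`‖L′(ρ̃,χ)⁻¹‖ ≤ M_inv`** from the inverse bound next to a simple real zero: if `L(ρ,χ) = 0`,
`L(·,χ)` is differentiable at `ρ` and `‖L(s,χ)⁻¹‖ ≤ M_inv(1 + |s − ρ|⁻¹)` for real `s ∈ (ρ, ρ + δ)`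
(`δ > 0`), then `M_inv⁻¹ ≤ ‖L′(ρ,χ)‖`, i.e. `‖L′(ρ,χ)⁻¹‖ ≤ M_inv` (the difference quotient
`L(s,χ)/(s−ρ)` has norm `≥ (M_inv(1 + (s−ρ)))⁻¹ → M_inv⁻¹`). [cite: MontgomeryVaughan2007, Thm 11.4] -/
theorem norm_inv_deriv_le_of_inv_bound {ρ Minv δ : ℝ} (hMinv : 0 < Minv) (hδ : 0 < δ)
    (hLρ : χ.LFunction ρ = 0) (hdiff : DifferentiableAt ℂ χ.LFunction ρ)
    (hL' : deriv χ.LFunction ρ ≠ 0)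
    (hpack : ∀ s : ℝ, ρ < s → s < ρ + δ →
      χ.LFunction s ≠ 0 ∧ ‖(χ.LFunction s)⁻¹‖ ≤ Minv * (1 + |s - ρ|⁻¹)) :
    ‖(deriv χ.LFunction ρ)⁻¹‖ ≤ Minv := by
  -- the slope along real `s ↓ ρ` tends to `L′(ρ)`
  have hslope := hdiff.hasDerivAt.tendsto_slope
  have hreal : Filter.Tendsto (fun s : ℝ => (s : ℂ)) (nhdsWithin ρ (Set.Ioi ρ))
      (nhdsWithin (ρ : ℂ) {(ρ : ℂ)}ᶜ) := by
    refine tendsto_nhdsWithin_of_tendsto_nhds_of_eventually_within _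
      ((Complex.continuous_ofReal.tendsto ρ).mono_left nhdsWithin_le_nhds) ?_
    filter_upwards [self_mem_nhdsWithin] with s hs
    simp only [Set.mem_compl_iff, Set.mem_singleton_iff, Complex.ofReal_inj]
    exact ne_of_gt hs
  have hcomp := (hslope.comp hreal).norm
  -- lower bound along the filter
  have hev : ∀ᶠ s : ℝ in nhdsWithin ρ (Set.Ioi ρ),
      (Minv * (1 + (s - ρ)))⁻¹ ≤ ‖slope χ.LFunction (ρ : ℂ) (s : ℂ)‖ := by
    have hmem : Set.Ioo ρ (ρ + δ) ∈ nhdsWithin ρ (Set.Ioi ρ) := Ioo_mem_nhdsGT (by linarith)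
    filter_upwards [hmem] with s hs
    have hsρ : 0 < s - ρ := by linarith [hs.1]
    obtain ⟨hne, hb⟩ := hpack s hs.1 hs.2
    rw [abs_of_pos hsρ] at hb
    show (Minv * (1 + (s - ρ)))⁻¹ ≤ ‖slope χ.LFunction (ρ : ℂ) (s : ℂ)‖
    rw [slope_def_field, hLρ, sub_zero, norm_div, ← Complex.ofReal_sub, Complex.norm_real,
      Real.norm_of_nonneg hsρ.le, le_div_iff₀ hsρ]
    have hLpos : 0 < ‖χ.LFunction (s : ℂ)‖ := norm_pos_iff.mpr hne
    have hb' : ‖χ.LFunction (s : ℂ)‖⁻¹ ≤ Minv * (1 + (s - ρ)⁻¹) := by rwa [norm_inv] at hb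
    rw [inv_le_comm₀ hLpos (by positivity)] at hb'
    calc (Minv * (1 + (s - ρ)))⁻¹ * (s - ρ) = (Minv * (1 + (s - ρ)⁻¹))⁻¹ := by
          field_simp
          ring
      _ ≤ ‖χ.LFunction (s : ℂ)‖ := hb'
  have hlim : Filter.Tendsto (fun s : ℝ => (Minv * (1 + (s - ρ)))⁻¹) (nhdsWithin ρ (Set.Ioi ρ))
      (nhds (Minv * (1 + (ρ - ρ)))⁻¹) := by
    have hc : Continuous fun s : ℝ => (Minv * (1 + (s - ρ))) := by fun_prop
    refine ((hc.tendsto ρ).mono_left nhdsWithin_le_nhds).inv₀ ?_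
    rw [sub_self, add_zero, mul_one]; exact hMinv.ne'
  rw [sub_self, add_zero, mul_one] at hlim
  have hge := le_of_tendsto_of_tendsto hlim hcomp hev
  rw [norm_inv, inv_le_comm₀ (norm_pos_iff.mpr hL') hMinv]
  simpa using hge

/-- `‖ζ(ρ)⁻¹‖ ≤ 2(1−ρ)` next to the pole: from `‖(ρ−1)ζ(ρ) − 1‖ ≤ 1/2` (`ρ < 1` real; the tree's
`ResidueValues.zeta_near_one`). [cite: Zhang2022LandauSiegel, §16 (16.10) p.92] -/
theorem norm_inv_zeta_le_of_near_one {ρ : ℝ} (hρ1 : ρ < 1)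
    (hζρ : ‖((ρ : ℂ) - 1) * riemannZeta ρ - 1‖ ≤ 1 / 2) :
    ‖(riemannZeta ρ)⁻¹‖ ≤ 2 * (1 - ρ) := by
  have hlow : 1 / 2 ≤ ‖((ρ : ℂ) - 1) * riemannZeta ρ‖ := by
    have h := norm_sub_norm_le (1 : ℂ) (1 - (((ρ : ℂ) - 1) * riemannZeta ρ))
    rw [sub_sub_cancel, norm_one, ← norm_neg (1 - _), neg_sub] at h
    linarith
  have hnorm1 : ‖((ρ : ℂ) - 1)‖ = 1 - ρ := by
    rw [← Complex.ofReal_one, ← Complex.ofReal_sub, Complex.norm_real, Real.norm_eq_abs,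
      abs_of_neg (by linarith)]
    ring
  rw [norm_mul, hnorm1] at hlow
  have hne : riemannZeta ρ ≠ 0 := by
    intro h; rw [h, norm_zero, mul_zero] at hlow; norm_num at hlow
  have hpos : 0 < ‖riemannZeta (ρ : ℂ)‖ := norm_pos_iff.mpr hne
  have h1ρ : (0 : ℝ) < 1 - ρ := by linarith
  rw [norm_inv, inv_le_comm₀ hpos (by positivity)]
  calc (2 * (1 - ρ))⁻¹ = 1 / 2 / (1 - ρ) := by
        rw [div_div, one_div, mul_comm]
    _ ≤ ‖riemannZeta (ρ : ℂ)‖ := by rw [div_le_iff₀ h1ρ]; linarith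

/-- **The residue at the exceptional-zero pole `s = ρ̃ − 1` is polynomially small.** For real
`0 ≤ ρ < 1`, `Im β₁ > 0`, purely imaginary `β₂` with `Im β₂ > 0`, `P ≥ 1`, `Λ ≥ 1`, `d ≥ 1`:
`‖L′(ρ,χ)⁻¹ · ζ(ρ+β₁)ℳ(ρ)ζ(ρ)⁻¹(d^{ρ−1})⁻¹ · P^{ρ−1+β₂}ω₁(ρ−1+β₂)/(ρ−1+β₂)‖
≤ M_inv·((Im β₁)⁻¹ + B_ζ)·M_U·2(1−ρ)·E·(e/Im β₂)`, given `‖L′(ρ,χ)⁻¹‖ ≤ M_inv`,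
`‖ζ(ρ+β₁) − (ρ+β₁−1)⁻¹‖ ≤ B_ζ`, `‖(ρ−1)ζ(ρ) − 1‖ ≤ 1/2`, `‖ℳ(ρ)‖ ≤ M_U`, `d^{1−ρ} ≤ E`. With
`1 − ρ ≤ K𝓛⁻²⁰²²` (Lemma 5.5) and `Im βⱼ ≍ α = π𝓛⁻⁹` this is `O(𝓛¹⁹⁻²⁰²²·M_U…)` — an "acceptable
error" for (16.12), NOT the printed `O(ε₁)`. [cite: Zhang2022LandauSiegel, §15 (15.15)–(15.16) p.85] -/
theorem norm_excZero_residue_le (M : ℂ → ℂ) {d : ℕ} (hd : d ≠ 0) {ρ P Λ MU Bζ Minv E : ℝ}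
    {β₁ β₂ : ℂ} (hρ0 : 0 ≤ ρ) (hρ1 : ρ < 1) (hP : 1 ≤ P) (hΛ : 1 ≤ Λ)
    (hβ₂ : β₂.re = 0) (hb₁ : 0 < β₁.im) (hb₂ : 0 < β₂.im)
    (hLinv : ‖(deriv χ.LFunction ρ)⁻¹‖ ≤ Minv) (hMinv : 0 ≤ Minv)
    (hζ1 : ‖riemannZeta (ρ + β₁) - ((ρ : ℂ) + β₁ - 1)⁻¹‖ ≤ Bζ) (hBζ : 0 ≤ Bζ)
    (hζρ : ‖((ρ : ℂ) - 1) * riemannZeta ρ - 1‖ ≤ 1 / 2) (hM : ‖M ρ‖ ≤ MU) (hMU : 0 ≤ MU)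
    (hE : (d : ℝ) ^ (1 - ρ) ≤ E) :
    ‖(deriv χ.LFunction ρ)⁻¹ *
        (riemannZeta (ρ + β₁) * M ρ * (riemannZeta ρ)⁻¹ * ((d : ℂ) ^ ((ρ : ℂ) - 1))⁻¹ *
          ((P : ℂ) ^ ((ρ : ℂ) - 1 + β₂) * GaussWeight.omega1 Λ ((ρ : ℂ) - 1 + β₂) /
            ((ρ : ℂ) - 1 + β₂)))‖ ≤
      Minv * ((β₁.im)⁻¹ + Bζ) * MU * (2 * (1 - ρ)) * E * (Real.exp 1 / β₂.im) := by
  -- `ζ(ρ + β₁)`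
  have hA₁ : ‖riemannZeta (ρ + β₁)‖ ≤ (β₁.im)⁻¹ + Bζ := by
    have him : ((ρ : ℂ) + β₁ - 1).im = β₁.im := by simp
    have hdist : β₁.im ≤ ‖(ρ : ℂ) + β₁ - 1‖ := by
      have h := Complex.abs_im_le_norm ((ρ : ℂ) + β₁ - 1)
      rwa [him, abs_of_pos hb₁] at h
    have hinv : ‖((ρ : ℂ) + β₁ - 1)⁻¹‖ ≤ (β₁.im)⁻¹ := by
      rw [norm_inv]; exact inv_anti₀ hb₁ hdist
    calc ‖riemannZeta (ρ + β₁)‖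
        ≤ ‖riemannZeta (ρ + β₁) - ((ρ : ℂ) + β₁ - 1)⁻¹‖ + ‖((ρ : ℂ) + β₁ - 1)⁻¹‖ := by
          have := norm_add_le (riemannZeta (ρ + β₁) - ((ρ : ℂ) + β₁ - 1)⁻¹) (((ρ : ℂ) + β₁ - 1)⁻¹)
          rwa [sub_add_cancel] at this
      _ ≤ Bζ + (β₁.im)⁻¹ := add_le_add hζ1 hinv
      _ = (β₁.im)⁻¹ + Bζ := add_comm _ _
  -- `ζ(ρ)⁻¹`
  have hA₃ := norm_inv_zeta_le_of_near_one hρ1 hζρ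
  -- `(d^{ρ−1})⁻¹`
  have hA₅ : ‖((d : ℂ) ^ ((ρ : ℂ) - 1))⁻¹‖ ≤ E := by
    rw [norm_cpow_inv_eq hd]
    have : (((ρ : ℂ) - 1).re) = ρ - 1 := by simp
    rw [this, show -(ρ - 1) = 1 - ρ by ring]
    exact hE
  -- the kernel at `u₁ = ρ − 1`
  have hK : ‖(P : ℂ) ^ ((ρ : ℂ) - 1 + β₂) * GaussWeight.omega1 Λ ((ρ : ℂ) - 1 + β₂) /
      ((ρ : ℂ) - 1 + β₂)‖ ≤ Real.exp 1 / β₂.im := by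
    have hP0 : 0 < P := by linarith
    have hw : (ρ : ℂ) - 1 + β₂ = ((ρ - 1 : ℝ) : ℂ) + (β₂.im : ℂ) * I := by
      apply Complex.ext <;> simp [hβ₂]
    have h1 : ‖(P : ℂ) ^ ((ρ : ℂ) - 1 + β₂)‖ ≤ 1 := by
      rw [Complex.norm_cpow_eq_rpow_re_of_pos hP0]
      have hre : ((ρ : ℂ) - 1 + β₂).re = ρ - 1 := by simp [hβ₂]
      rw [hre]
      exact Real.rpow_le_one_of_one_le_of_nonpos hP (by linarith)
    have h2 : ‖GaussWeight.omega1 Λ ((ρ : ℂ) - 1 + β₂)‖ ≤ Real.exp 1 := by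
      rw [hw, GaussWeight.norm_omega1, Real.exp_le_exp]
      have hsq : (ρ - 1) ^ 2 ≤ 1 := by nlinarith
      have hΛ4 : 0 < 4 * Λ := by linarith
      calc ((ρ - 1) ^ 2 - β₂.im ^ 2) / (4 * Λ) ≤ 1 / (4 * Λ) := by
            apply div_le_div_of_nonneg_right _ hΛ4.le; nlinarith [sq_nonneg β₂.im]
        _ ≤ 1 := by rw [div_le_one hΛ4]; linarith
    have h3 : ‖((ρ : ℂ) - 1 + β₂)⁻¹‖ ≤ (β₂.im)⁻¹ := by
      have him : ((ρ : ℂ) - 1 + β₂).im = β₂.im := by simp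
      have hdist : β₂.im ≤ ‖(ρ : ℂ) - 1 + β₂‖ := by
        have h := Complex.abs_im_le_norm ((ρ : ℂ) - 1 + β₂)
        rwa [him, abs_of_pos hb₂] at h
      rw [norm_inv]; exact inv_anti₀ hb₂ hdist
    rw [div_eq_mul_inv, norm_mul, norm_mul, div_eq_mul_inv]
    calc ‖(P : ℂ) ^ ((ρ : ℂ) - 1 + β₂)‖ * ‖GaussWeight.omega1 Λ ((ρ : ℂ) - 1 + β₂)‖ *
          ‖((ρ : ℂ) - 1 + β₂)⁻¹‖ ≤ 1 * Real.exp 1 * (β₂.im)⁻¹ := by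
          gcongr
      _ = Real.exp 1 * (β₂.im)⁻¹ := by ring
  -- assemble
  rw [norm_mul, norm_mul, norm_mul, norm_mul, norm_mul]
  have hb₁' : 0 ≤ (β₁.im)⁻¹ + Bζ := by positivity
  have hE0 : 0 ≤ E := le_trans (by positivity) hE
  have hprod0 : 0 ≤ (β₁.im⁻¹ + Bζ) * MU * (2 * (1 - ρ)) * E :=
    mul_nonneg (mul_nonneg (mul_nonneg hb₁' hMU) (by linarith)) hE0
  calc ‖(deriv χ.LFunction ↑ρ)⁻¹‖ * (‖riemannZeta (↑ρ + β₁)‖ * ‖M ↑ρ‖ * ‖(riemannZeta ↑ρ)⁻¹‖ *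
        ‖((d : ℂ) ^ ((ρ : ℂ) - 1))⁻¹‖ *
        ‖(P : ℂ) ^ ((ρ : ℂ) - 1 + β₂) * GaussWeight.omega1 Λ ((ρ : ℂ) - 1 + β₂) / ((ρ : ℂ) - 1 + β₂)‖)
      ≤ Minv * (((β₁.im)⁻¹ + Bζ) * MU * (2 * (1 - ρ)) * E * (Real.exp 1 / β₂.im)) := by
        gcongr
  _ = _ := by ring

end ExcZero

end Literature.NumberTheory.LFunctions.Zhang2022.Eq1610
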